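import Summits.Ventures.HSemireg.Pad4TowerAlphabetMu4
import Summits.Ventures.HSemireg.Pad4TowerRuleDMu4Slice

/-!
# Venture HSemireg — PAD-4 on 𝔅(μ₄): FRAME POINTS and the FRAME LIFT of (F1ℝ) cells — the slice embedding of
# `Pad4TowerRuleDMu4Slice` with one frame per factor — and the move table of `𝒰` inside a frame

HONEST FRAMING. Third of four files (see `Pad4TowerAlphabetMu4`); seat `hodge-semireg-assembly-p1` g1. Purpose: the reduction of
LEMMA X∞-B on 𝔅(μ₄) to the landed (F1ℝ) kernel theorem `Pad4TowerXInf.Admissible.no_fc` (file `Pad4TowerXInfMu4`). A fully charged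
cell of `𝒰⁴` has on every factor a letter with a definite axis, i.e. a FRAME `{k_f, k_f + 2}` of null directions (PAD4-BALANCED §1′
FRAMES; memo (0.1) «(a,b)_u and (b,a)_{−u} are the same point»); reading its light-cone coordinates `(a_f, b_f)` in those frames
gives a `Pad4TowerLemmaT.Cell`. THIS FILE: §1 `framePt k v` (the 𝔅(μ₄) point with frame coordinates `(v 0, v 1)` in the frame of
`k`), `frameLift ε Y` (one frame direction `ε f` per factor; `frameLift_zero`: `ε ≡ 0` is typer-2's `sliceCell`), frame data
(`frame_framePt`, `frame_framePt_side`: side `s` ↦ direction `k + dirOf s`, coordinate `2·v s`), injectivity, and `inUscr_of_framePt`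
(a frame point in `𝒰` is an (F1ℝ) `𝒰`-letter: `Pad4TowerXInfA.InUscr`'s clause); §2 the MOVE TABLE INSIDE A FRAME (memo (0.2),
all four phases): from a CHARGED frame point, every `𝒰`-letter strictly below ∕ above it along a null direction lies in the same
frame, the direction being `k` or `k + 2` (`dir_of_below_framePt`, `dir_of_above_framePt`: an orthogonal step leaves the axis), and
the move changes exactly the one frame coordinate on that side, inside `ℕ` (`below_framePt_side`, `above_framePt_side`);
`DirOK.ne_add_two` (a cover direction is never the antipode of the coordinate it resolves).

WHAT IS NOT HERE ∕ NOT IN LEAN: anything about configurations (next file); the meaning of frames beyond the arithmetic. Nothing is a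
statement about a variety, a sheaf, `σ`, a seed or an abelian variety; NOTHING HERE SAYS THAT HC ∕ HC_CM ∕ HC_AV ∕ W₆ ∕ HC_Kum4Type
HOLDS OR FAILS. No `instance`, no notation, no named fact, 0 `sorry`; axioms standard.

SOURCES (sha16): BC5-PLAN-g4-MEMO.md v4.1 df3e4f41db3c2fcf (0.1)–(0.2); PAD4-BALANCED-search-1.md §1′ FRAMES (via
`Pad4TowerRuleDMu4.lean` 7f3a78a9d76f5e0c docstring); `Pad4TowerRuleDMu4Slice.lean` 19fb9aba7eb52cda (p554734: `sliceCell`, `dirOf`);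
`Pad4TowerLemmaT.lean` bfb2cc0a1a90b649 (`Cell`, `isO`); `Pad4TowerAlphabetMu4.lean` (this seat).
-/

namespace Summit.Ventures.HSemireg.Pad4Tower

open Finset

/-! ## §1 Frame points and the frame lift (the slice embedding of `Pad4TowerRuleDMu4Slice`, one frame per factor) -/

/-- the point with light-cone coordinates `(v 0, v 1)` in the frame `{k, k+2}`: `v 0·n_{i^k} + v 1·n_{i^{k+2}} =
(v 0 + v 1, (v 0 − v 1)·conj(i^k))`. For `k = 0` this is `sliceCell`'s factor map. -/
def framePt (k : Fin 4) (v : Fin 2 → ℕ) : BPoint := ray (lpt (v 0) k) (k + 2) (v 1)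

/-- the FRAME LIFT of an (F1ℝ) cell along a choice of frame direction `ε f` per factor. -/
def frameLift (ε : Fin 4 → Fin 4) (Y : Cell) : MCell := fun f => framePt (ε f) (Y f)

/-- components of a frame point. -/
theorem framePt_eq (k : Fin 4) (v : Fin 2 → ℕ) :
    framePt k v = ((v 0 : ℤ) + v 1, ((v 0 : ℤ) - v 1) * ![1, 0, -1, 0] k, ((v 0 : ℤ) - v 1) * ![0, -1, 0, 1] k) := by
  fin_cases k <;> simp [framePt, lpt_eq] <;> ring

/-- the frame lift along the constant frame `0` is the slice embedding of `Pad4TowerRuleDMu4Slice`. -/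
theorem frameLift_zero (Y : Cell) : frameLift (fun _ => 0) Y = sliceCell Y := by
  funext f
  simp only [frameLift, framePt_eq, sliceCell]
  simp

/-- frame data of a frame point: adapted to `k` and `k + 2`, with coordinates `2·v 0` and `2·v 1`. -/
theorem frame_framePt (k : Fin 4) (v : Fin 2 → ℕ) :
    Adapted (framePt k v) k ∧ Adapted (framePt k v) (k + 2) ∧ coord (framePt k v) k = 2 * (v 0 : ℤ) ∧
      coord (framePt k v) (k + 2) = 2 * (v 1 : ℤ) := by
  fin_cases k <;> simp [framePt_eq, Adapted, coord] <;> constructor <;> ring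

/-- the two sides as a disjunction (for case splits that keep `dirOf` computable). -/
private theorem fin2_eq (s : Fin 2) : s = 0 ∨ s = 1 := by
  fin_cases s <;> simp

/-- side `0` of the frame `k` is the direction `k` … -/
theorem add_dirOf_zero (k : Fin 4) : k + dirOf 0 = k := by
  simp [dirOf]

/-- … side `1` the direction `k + 2`. -/
theorem add_dirOf_one (k : Fin 4) : k + dirOf 1 = k + 2 := by
  simp [dirOf]

/-- the side-`s` coordinate of a frame point: direction `k + dirOf s`, value `2·v s`, adapted. -/
theorem frame_framePt_side (k : Fin 4) (v : Fin 2 → ℕ) (s : Fin 2) :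
    Adapted (framePt k v) (k + dirOf s) ∧ coord (framePt k v) (k + dirOf s) = 2 * (v s : ℤ) := by
  obtain ⟨h0, h2, c0, c2⟩ := frame_framePt k v
  rcases fin2_eq s with rfl | rfl
  · rw [add_dirOf_zero]; exact ⟨h0, c0⟩
  · rw [add_dirOf_one]; exact ⟨h2, c2⟩

/-- a frame point is the apex iff both coordinates vanish. -/
theorem framePt_eq_O_iff (k : Fin 4) (v : Fin 2 → ℕ) : framePt k v = (0, 0, 0) ↔ v 0 = 0 ∧ v 1 = 0 := by
  rw [framePt_eq]
  fin_cases k <;> simp [Prod.ext_iff] <;> omega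

/-- frame points in one frame are determined by their coordinates. -/
theorem framePt_injective (k : Fin 4) : Function.Injective (framePt k) := by
  intro v w h
  rw [framePt_eq, framePt_eq] at h
  have h' : (v 0 : ℤ) = w 0 ∧ (v 1 : ℤ) = w 1 := by
    fin_cases k <;> simp [Prod.ext_iff] at h <;> omega
  funext s
  fin_cases s <;> simp <;> omega

/-- the frame lift is injective. -/
theorem frameLift_injective (ε : Fin 4 → Fin 4) : Function.Injective (frameLift ε) := fun _ _ h =>
  funext fun f => framePt_injective (ε f) (congrFun h f)

/-- a frame point lying in `𝒰` is an (F1ℝ) `𝒰`-letter: `O`, a pure ray `(c,0)`∕`(0,c)` or a simple tower `(c+1,1)`∕`(1,c+1)`. -/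
theorem inUscr_of_framePt {k : Fin 4} {v : Fin 2 → ℕ} (h : InUMu4 (framePt k v)) :
    v 0 = 0 ∨ v 1 = 0 ∨ (min (v 0) (v 1) = 1 ∧ 2 ≤ max (v 0) (v 1)) := by
  rw [framePt_eq] at h
  rcases (inUMu4_iff _).1 h with h0 | ⟨k', c, hc, h | h⟩
  · simp [Prod.ext_iff] at h0; omega
  · rw [lpt_eq] at h
    fin_cases k <;> fin_cases k' <;> simp [Prod.ext_iff] at h <;> omega
  · rw [towPt_eq] at h
    fin_cases k <;> fin_cases k' <;> simp [Prod.ext_iff] at h <;> omega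

/-- hence a CHARGED frame point of `𝒰` has two different coordinates. -/
theorem ne_of_inU_framePt {k : Fin 4} {v : Fin 2 → ℕ} (h : InUMu4 (framePt k v)) (h0 : framePt k v ≠ (0, 0, 0)) :
    v 0 ≠ v 1 := by
  have := inUscr_of_framePt h
  rw [Ne, framePt_eq_O_iff] at h0
  omega

/-! ## §2 Moves from a charged frame point inside `𝒰` stay in its frame (memo (0.2), all four phases) -/

/-- DOWN from a charged frame point: a `𝒰`-letter strictly below it along a null direction `r` lies in the frame, `r ∈ {k, k+2}`
(an orthogonal step leaves the axis). -/
theorem dir_of_below_framePt {k r : Fin 4} {v : Fin 2 → ℕ} (hv : v 0 ≠ v 1) {y : BPoint} (hy : InUMu4 y)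
    (hlt : y.1 < (framePt k v).1) (h : framePt k v = ray y r ((framePt k v).1 - y.1)) : r = k ∨ r = k + 2 := by
  have hax := hy.axis
  obtain ⟨y₁, y₂, y₃⟩ := y
  rw [framePt_eq] at h hlt
  simp only at hlt hax
  have h1 := congrArg (fun p : BPoint => p.2.1) h
  have h2 := congrArg (fun p : BPoint => p.2.2) h
  simp only at h1 h2
  have hv' : (v 0 : ℤ) ≠ v 1 := by exact_mod_cast hv
  fin_cases k <;> fin_cases r <;> simp at h1 h2 ⊢ <;> omega

/-- DOWN along the own direction `k`: the `a`-coordinate drops, inside `ℕ` (effectiveness of the lower letter). -/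
theorem below_framePt_self {k : Fin 4} {v : Fin 2 → ℕ} {y : BPoint} (hy : InUMu4 y) {d : ℤ}
    (h : framePt k v = ray y k d) : ∃ w : Fin 2 → ℕ, y = framePt k w ∧ (w 0 : ℤ) + d = v 0 ∧ w 1 = v 1 := by
  have hl := hy.linf
  obtain ⟨y₁, y₂, y₃⟩ := y
  rw [framePt_eq] at h
  have h0 := congrArg (fun p : BPoint => p.1) h
  have h1 := congrArg (fun p : BPoint => p.2.1) h
  have h2 := congrArg (fun p : BPoint => p.2.2) h
  simp only at h0 h1 h2 hl
  have hda : d ≤ v 0 := by fin_cases k <;> simp at h1 h2 <;> omega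
  refine ⟨![((v 0 : ℤ) - d).toNat, v 1], ?_, by simp; omega, by simp⟩
  rw [framePt_eq]
  fin_cases k <;> simp [Prod.ext_iff] at h1 h2 ⊢ <;> omega

/-- the frame point in the antipodal frame with swapped coordinates is the same point. -/
theorem framePt_swap (k : Fin 4) (v : Fin 2 → ℕ) : framePt (k + 2) ![v 1, v 0] = framePt k v := by
  rw [framePt_eq, framePt_eq]
  fin_cases k <;> simp <;> ring

/-- DOWN along a frame direction not antipodal to the side `s`: it is the side-`s` direction and only the coordinate `s` drops
(the one-coordinate form used by the transfer; sides `0 ↔ k`, `1 ↔ k+2`). -/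
theorem below_framePt_side {k r : Fin 4} {v : Fin 2 → ℕ} (hv : v 0 ≠ v 1) {y : BPoint} (hy : InUMu4 y)
    (hlt : y.1 < (framePt k v).1) (h : framePt k v = ray y r ((framePt k v).1 - y.1)) (s : Fin 2)
    (hr : r ≠ k + dirOf s + 2) : ∃ w : Fin 2 → ℕ, y = framePt k w ∧ (∀ u, u ≠ s → w u = v u) ∧ w s < v s := by
  rcases fin2_eq s with rfl | rfl
  · rw [add_dirOf_zero] at hr
    rcases dir_of_below_framePt hv hy hlt h with rfl | rfl
    · obtain ⟨w, hw, h0, h1⟩ := below_framePt_self hy h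
      refine ⟨w, hw, fun u hu => ?_, by omega⟩
      rcases fin2_eq u with rfl | rfl
      · exact absurd rfl hu
      · exact h1
    · exact absurd rfl hr
  · rw [add_dirOf_one] at hr
    replace hr : r ≠ k := by omega
    rcases dir_of_below_framePt hv hy hlt h with rfl | rfl
    · exact absurd rfl hr
    · rw [← framePt_swap] at h hlt
      obtain ⟨w, hw, h0, h1⟩ := below_framePt_self hy h
      simp only [Matrix.cons_val_zero, Matrix.cons_val_one] at h0 h1
      refine ⟨![w 1, w 0], ?_, fun u hu => ?_, by simp; omega⟩
      · rw [hw, ← framePt_swap, (by omega : k + 2 + 2 = k)]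
      · rcases fin2_eq u with rfl | rfl
        · simp [h1]
        · exact absurd rfl hu

/-- UP from a charged frame point inside `𝒰`: the direction lies in the frame. -/
theorem dir_of_above_framePt {k r : Fin 4} {v : Fin 2 → ℕ} (hv : v 0 ≠ v 1) {e : ℤ} (he : 1 ≤ e)
    (hy : InUMu4 (ray (framePt k v) r e)) : r = k ∨ r = k + 2 := by
  have hax := hy.axis
  rw [framePt_eq] at hax
  have hv' : (v 0 : ℤ) ≠ v 1 := by exact_mod_cast hv
  fin_cases k <;> fin_cases r <;> simp at hax ⊢ <;> omega

/-- UP along the own direction: the `a`-coordinate grows. -/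
theorem above_framePt_self (k : Fin 4) (v : Fin 2 → ℕ) {e : ℤ} (he : 0 ≤ e) :
    ∃ w : Fin 2 → ℕ, ray (framePt k v) k e = framePt k w ∧ (w 0 : ℤ) = v 0 + e ∧ w 1 = v 1 := by
  refine ⟨![v 0 + e.toNat, v 1], ?_, by simp; omega, by simp⟩
  rw [framePt_eq, framePt_eq]
  fin_cases k <;> simp [Prod.ext_iff] <;> omega

/-- UP along a frame direction not antipodal to the side `s`: only the coordinate `s` grows. -/
theorem above_framePt_side {k r : Fin 4} {v : Fin 2 → ℕ} (hv : v 0 ≠ v 1) {e : ℤ} (he : 1 ≤ e)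
    (hy : InUMu4 (ray (framePt k v) r e)) (s : Fin 2) (hr : r ≠ k + dirOf s + 2) :
    ∃ w : Fin 2 → ℕ, ray (framePt k v) r e = framePt k w ∧ (∀ u, u ≠ s → w u = v u) ∧ v s < w s := by
  rcases fin2_eq s with rfl | rfl
  · rw [add_dirOf_zero] at hr
    rcases dir_of_above_framePt hv he hy with rfl | rfl
    · obtain ⟨w, hw, h0, h1⟩ := above_framePt_self r v (by omega : 0 ≤ e)
      refine ⟨w, hw, fun u hu => ?_, by omega⟩
      rcases fin2_eq u with rfl | rfl
      · exact absurd rfl hu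
      · exact h1
    · exact absurd rfl hr
  · rw [add_dirOf_one] at hr
    replace hr : r ≠ k := by omega
    rcases dir_of_above_framePt hv he hy with rfl | rfl
    · exact absurd rfl hr
    · obtain ⟨w, hw, h0, h1⟩ := above_framePt_self (k + 2) ![v 1, v 0] (by omega : 0 ≤ e)
      rw [framePt_swap] at hw
      simp only [Matrix.cons_val_zero, Matrix.cons_val_one] at h0 h1
      refine ⟨![w 1, w 0], ?_, fun u hu => ?_, by simp; omega⟩
      · rw [hw, ← framePt_swap, (by omega : k + 2 + 2 = k)]
      · rcases fin2_eq u with rfl | rfl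
        · simp [h1]
        · exact absurd rfl hu

/-- an admissible cover direction is never the antipode of the coordinate it resolves. -/
theorem DirOK.ne_add_two {x : BPoint} {k a : Fin 4} (h : DirOK x k a) : a ≠ k + 2 := by
  rcases h with rfl | ⟨-, h⟩
  · fin_cases a <;> decide
  · exact h

/-- O-factors of an (F1ℝ) cell are exactly the apex factors of its frame lift. -/
theorem isO_iff_frameLift (ε : Fin 4 → Fin 4) (Y : Cell) (f : Fin 4) : isO Y f ↔ frameLift ε Y f = (0, 0, 0) :=
  (framePt_eq_O_iff (ε f) (Y f)).symm

/-- changing one factor of the (F1ℝ) cell changes one factor of the lift. -/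
theorem frameLift_update (ε : Fin 4 → Fin 4) (Y : Cell) (g : Fin 4) (w : Fin 2 → ℕ) :
    frameLift ε (Function.update Y g w) = Function.update (frameLift ε Y) g (framePt (ε g) w) := by
  funext f
  by_cases hf : f = g
  · subst hf; simp [frameLift]
  · simp [frameLift, hf]

end Summit.Ventures.HSemireg.Pad4Tower
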